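import Literature.NumberTheory.EllipticCurves.Kriz2020.RankOnePConverse
import Literature.NumberTheory.EllipticCurves.CubeSumPrimeDescentInputs
import Literature.NumberTheory.EllipticCurves.LeadingTerm
import Literature.NumberTheory.EllipticCurves.BSDAnalyticRankProofs
import HarnessLib

/-!
# Sylvester's problem (1879) for primes `p ≡ 4, 7, 8 (mod 9)` as a tree theorem modulo ONE unrefereed input: Kříž's rank-one `3`-converse for `y² = x³ + D` (`rankOne_threeConverse_mordellCurve`)

HONEST FRAMING (cell `bsd-cn100`, companion at `p = 3` of `Kriz2020/CongruentNumberDensityOneProofs.lean`).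
Sylvester's conjecture — every prime `p ≡ 4, 7, 8 (mod 9)` is a sum of two rational cubes
(Dasgupta–Voight 2018, Conjecture 1: "If `p ≡ 4, 7, 8 (mod 9)`, then `rank E_p(ℚ) > 0`",
`E_p : x³ + y³ = p`) — is OPEN in print: Dasgupta–Voight 2018, Thm. 2 prove it for `p ≡ 4, 7 (mod 9)`
with `3` not a cube modulo `p`; Elkies (1994) announced `p ≡ 4, 7 (mod 9)` without publication; "We
are not aware of any results concerning the case `p ≡ 8 (mod 9)`" (loc. cit.). Two UNREFEREED
preprints claim it in full as a corollary of a rank-one `p`-converse at the ramified prime `p = 3`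
of `K = ℚ(√−3)`: Kříž, arXiv:2002.04767v5, Thm. 10.14 (2), and Fan–Wan, arXiv:2304.09806v2,
Thm. 1.2. This file proves NOTHING from those preprints. It shows, sorry-free, that Sylvester's
statement follows from

* ONE named hypothesis transcribing the preprint claim: `hK3 : rankOne_threeConverse_mordellCurve`
  (`Kriz2020/RankOnePConverse.lean`: for `D ≠ 0`, `corank_{ℤ₃} Sel_{3^∞}(E_D/ℚ) = 1 ⟹
  ord_{s=1} L(E_D, s) = 1`, `E_D : y² = x³ + D`), and
* PUBLISHED inputs that are named facts of the tree: Gross–Zagier–Kolyvagin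
  (`hGZK : rank_eq_analyticRank_of_analyticRank_le_one`, bsd.S17, `LeadingTerm.lean`); Satgé's
  `3`-descent bound (`hSel : satge_selmerCorank_three_le_one_of_prime_mod_nine`) and the root number
  `w(E_p) = −1` (`hw : rootNumber_cubeSumCurve_prime_eq_neg_one_of_mod_nine`), both in
  `CubeSumPrimeDescentInputs.lean`; and the `p`-parity theorem of Dokchitser–Dokchitser 2010 at
  `p = 3` (`hpar : p_parity`, bsd.S19, `BSDSelmer.lean`),

exactly as in the source: Kříž v5, proof of Thm. 10.14 (SP_v5.tex l. 10971): "by standard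
`3`-descent (see [DasguptaVoight], [Satge]) … `r_3(E_d) ≤ 1` for `d ≡ 4, 7, 8 (mod 9)` … the
global root number is `−1` … by the `p`-parity theorem `r_3(E_d)` is odd and hence … `r_3(E_d) = 1`.
Now the rank `1` statement follows from" [the display `r_3 ≤ 1 ⟹ r_an = r_alg = r_3`, i.e.
Thm. 10.13 at `p = 3` plus Gross–Zagier–Kolyvagin]; Fan–Wan v2, proof of Thm. 1.2: "By [Satgé,
Theorem 2.9], the `3`-adic Selmer rank of `E_p` is less than or equal to `2`. By the parity result
[DD, Theorem 1.9], the `3`-adic Selmer rank is odd. Thus it must be `1`. By Theorem 1.1, the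
`L`-function of `E_p` has order `1`. Then by the theorem of Gross–Zagier and Kolyvagin, the
Mordell–Weil rank of `E_p` is also one. Consequently, the equation `x³ + y³ = p` has infinitely
many rational solutions."

The complementary classes are settled in the tree unconditionally and elementarily: a prime
`p ≡ 2, 5 (mod 9)`, `p ≠ 2`, is NOT a sum of two rational cubes
(`Literature.NumberTheory.DiophantineGeometry.not_exists_rat_cube_add_cube_eq_prime`,
Pépin–Lucas–Sylvester; Kříž v5 Thm. 10.14 (1)); `p ≡ 1 (mod 9)` is not covered by any conjecture
of this shape (rank `0` or `2`, Rodriguez-Villegas–Zagier).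

## What is proved (model: `E_d : x³ + y³ = d` ↦ `mordellCurve (-(432 d²)) : Y² = X³ − 432 d²`)

1. `exists_cube_add_cube_of_mordellCurve_equation` — the model link: for `d ≠ 0`, a rational
   affine point `(X, Y)` on `Y² = X³ − 432 d²` gives `x³ + y³ = d` with
   `x = (36 d + Y)/(6X)`, `y = (36 d − Y)/(6X)` (`X ≠ 0` automatically, since `−432 d² < 0`);
   Dasgupta–Voight 2018 §1.1 ("The equation for `E_n` can be transformed via a change of variables
   to yield the Weierstrass equation `y² = x³ − 432n²`").
2. `exists_cube_add_cube_of_selmerCorank_three_eq_one` — Kříž v5 Thm. 10.14, second display, as a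
   conditional: `hK3 → hGZK → d ≠ 0 → r_3(E_d) = 1 → ∃ x y : ℚ, x³ + y³ = d`.
3. `selmerCorank_eq_one_of_le_one_of_rootNumber_eq_neg_one` — the parity step: `p_parity W p`,
   `corank ≤ 1`, `w = −1` ⟹ `corank = 1`.
4. `selmerCorank_three_cubeSumCurve_prime_eq_one` — `r_3(E_p) = 1` for primes `p ≡ 4, 7, 8 (mod 9)`
   from `hSel`, `hw`, `hpar` (no preprint input).
5. `analyticRank_eq_one_cubeSumCurve_prime_of_converse` /
   `mordellWeilRank_eq_one_cubeSumCurve_prime_of_converse` — `ord_{s=1} L(E_p, s) = 1` and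
   `rank E_p(ℚ) = 1` for such `p`, modulo `hK3` (and `hGZK` for the rank).
6. `sylvester_exists_cube_add_cube_eq_prime_of_converse` — **Sylvester's statement modulo `hK3`**:
   `hK3 → hGZK → hSel → hw → hpar → ∀ p prime, p ≡ 4, 7, 8 (mod 9) → ∃ x y : ℚ, x³ + y³ = p`.

Trust base of (6), by name: `rankOne_threeConverse_mordellCurve` (UNREFEREED CLAIM — the one
hypothesis this cell isolates), `rank_eq_analyticRank_of_analyticRank_le_one` (GZK),
`satge_selmerCorank_three_le_one_of_prime_mod_nine` (Satgé 1986 Thm. 2.9),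
`rootNumber_cubeSumCurve_prime_eq_neg_one_of_mod_nine` (Dasgupta–Voight 2018 (2)), `p_parity`
(Dokchitser–Dokchitser 2010 Thm. 1.4) — and nothing else.
-/

open scoped Classical

open WeierstrassCurve

namespace Literature.NumberTheory.EllipticCurves

/-! ### The model link `Y² = X³ − 432 d²  ⟶  x³ + y³ = d` -/

/-- **A rational point on `Y² = X³ − 432 d²` (`d ≠ 0`) makes `d` a sum of two rational cubes**:
`x = (36d + Y)/(6X)`, `y = (36d − Y)/(6X)` satisfy `x³ + y³ = d (Y² + 432 d²)/X³ = d`; here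
`X ≠ 0` because `Y² = −432 d²` has no rational solution. The inverse of the classical change of
variables `x³ + y³ = d ↦ y² = x³ − 432 d²` (Dasgupta–Voight 2018, §1.1; Satgé 1986, p. 295).
[cite: DasguptaVoight2018, §1.1 (the Weierstrass equation y² = x³ − 432n² of E_n)] -/
theorem exists_cube_add_cube_of_mordellCurve_equation {d X Y : ℚ} (hd : d ≠ 0)
    (h : (mordellCurve (-(432 * d ^ 2))).toAffine.Equation X Y) :
    ∃ x y : ℚ, x ^ 3 + y ^ 3 = d := by
  have heq : Y ^ 2 = X ^ 3 - 432 * d ^ 2 := by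
    rw [Affine.equation_iff] at h
    simp only [mordellCurve] at h
    linear_combination h
  have hX : X ≠ 0 := by
    rintro rfl
    have h1 : (0 : ℚ) ≤ Y ^ 2 := sq_nonneg Y
    have h2 : (0 : ℚ) < 432 * d ^ 2 := by positivity
    have h3 : Y ^ 2 = -(432 * d ^ 2) := by rw [heq]; ring
    linarith
  have hX6 : (6 * X) ^ 3 ≠ 0 := pow_ne_zero 3 (mul_ne_zero (by norm_num) hX)
  refine ⟨(36 * d + Y) / (6 * X), (36 * d - Y) / (6 * X), ?_⟩
  rw [div_pow, div_pow, ← add_div, div_eq_iff hX6]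
  linear_combination 216 * d * heq

/-! ### Kříž v5 Thm. 10.14, second display, as a conditional -/

/-- **`r_3(E_d) = 1` makes `d` a sum of two rational cubes — modulo the rank-one `3`-converse**
(Kříž, arXiv:2002.04767v5, Thm. 10.14: "Suppose `r_3(E_d/ℚ) ≤ 1`. Then
`r_an(E_d/ℚ) = r_alg(E_d/ℚ) = r_3(E_d/ℚ)`", case `r_3 = 1`, with its consequence "there exist
`x, y ∈ ℚ` with `x³ + y³ = d`"). For `d ≠ 0`: the HYPOTHESIS `hK3` turns `corank_{ℤ₃} Sel_{3^∞} = 1`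
on `E_d : Y² = X³ − 432 d²` into `ord_{s=1} L(E_d, s) = 1`, Gross–Zagier–Kolyvagin (`hGZK`) into
`rank E_d(ℚ) = 1`, a curve with `a₁ = a₃ = 0` and nonzero rank has an affine rational point
(`exists_nonsingular_ne_zero_of_mordellWeilRank_ne_zero`), and the model link finishes.
[cite: Kriz2020, Thm. 10.14 of v5 (second display, case r_3 = 1; = Cor. 8.6 of v1)] -/
theorem exists_cube_add_cube_of_selmerCorank_three_eq_one
    (hK3 : rankOne_threeConverse_mordellCurve)
    (hGZK : rank_eq_analyticRank_of_analyticRank_le_one)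
    {d : ℚ} (hd : d ≠ 0) (h : (mordellCurve (-(432 * d ^ 2))).selmerCorank 3 = 1) :
    ∃ x y : ℚ, x ^ 3 + y ^ 3 = d := by
  have hD : (-(432 * d ^ 2) : ℚ) ≠ 0 := neg_ne_zero.mpr (by positivity)
  haveI := isElliptic_mordellCurve hD
  have hran : (mordellCurve (-(432 * d ^ 2))).analyticRank = 1 := hK3 hD h
  have hMW : (mordellCurve (-(432 * d ^ 2))).mordellWeilRank = 1 := by
    rw [(hGZK (mordellCurve (-(432 * d ^ 2))) hran.le).1, hran]
  obtain ⟨X, Y, hXY, -⟩ := exists_nonsingular_ne_zero_of_mordellWeilRank_ne_zero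
    (mordellCurve (-(432 * d ^ 2))) rfl rfl (by rw [hMW]; exact one_ne_zero)
  exact exists_cube_add_cube_of_mordellCurve_equation hd hXY.1

/-! ### The parity step and `r_3(E_p) = 1` for primes `p ≡ 4, 7, 8 (mod 9)` -/

/-- **The parity step** (Kříž v5, proof of Thm. 10.14: "by the `p`-parity theorem … `r_3(E_d)` is
odd and hence … `r_3(E_d) = 1`"; Fan–Wan v2, proof of Thm. 1.2). If `(-1)^{corank Sel_{p^∞}(E)} =
w(E)` (`p_parity`), `corank ≤ 1` and `w(E) = −1`, then `corank Sel_{p^∞}(E/ℚ) = 1`.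
[cite: Kriz2020, proof of Thm. 10.14 (v5), parity step] -/
theorem selmerCorank_eq_one_of_le_one_of_rootNumber_eq_neg_one (W : WeierstrassCurve ℚ)
    [W.IsElliptic] (p : ℕ) [Fact p.Prime] (hpar : p_parity W p) (hle : W.selmerCorank p ≤ 1)
    (hw : W.rootNumber = -1) : W.selmerCorank p = 1 := by
  unfold p_parity at hpar
  rcases Nat.le_one_iff_eq_zero_or_eq_one.mp hle with h0 | h1
  · rw [h0, hw] at hpar
    norm_num at hpar
  · exact h1

/-- **`corank_{ℤ₃} Sel_{3^∞}(E_p/ℚ) = 1` for every prime `p ≡ 4, 7, 8 (mod 9)`** (`E_p : x³ + y³ = p`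
on `Y² = X³ − 432 p²`), from PUBLISHED inputs only: Satgé's `3`-descent bound `≤ 1` (`hSel`), the
root number `−1` (`hw`, Dasgupta–Voight 2018 (2)) and the `3`-parity theorem (`hpar`,
Dokchitser–Dokchitser 2010). This is the sentence "`r_3(E_d) = 1` for `d ≡ 4, 7, 8 (mod 9)`" of
Kříž v5 (proof of Thm. 10.14) and "Thus it must be `1`" of Fan–Wan v2 (proof of Thm. 1.2).
[cite: DasguptaVoight2018, §1.1 displays (1)–(2)] [cite: Satge1986, Thm. 2.9]
[cite: DokchitserDokchitserAnnals2010, Thm. 1.4] -/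
theorem selmerCorank_three_cubeSumCurve_prime_eq_one
    (hSel : satge_selmerCorank_three_le_one_of_prime_mod_nine)
    (hw : rootNumber_cubeSumCurve_prime_eq_neg_one_of_mod_nine)
    (hpar : ∀ (W : WeierstrassCurve ℚ) [W.IsElliptic] (p : ℕ) [Fact p.Prime], p_parity W p)
    {p : ℕ} (hp : p.Prime) (h9 : p % 9 = 4 ∨ p % 9 = 7 ∨ p % 9 = 8) :
    (mordellCurve (-(432 * (p : ℚ) ^ 2))).selmerCorank 3 = 1 := by
  have hp0 : (p : ℚ) ≠ 0 := by exact_mod_cast hp.ne_zero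
  have hD : (-(432 * (p : ℚ) ^ 2) : ℚ) ≠ 0 := neg_ne_zero.mpr (by positivity)
  haveI := isElliptic_mordellCurve hD
  haveI : Fact (Nat.Prime 3) := ⟨Nat.prime_three⟩
  exact selmerCorank_eq_one_of_le_one_of_rootNumber_eq_neg_one _ 3 (hpar _ 3) (hSel hp h9)
    (hw hp h9)

/-! ### Sylvester's statement modulo the rank-one `3`-converse -/

/-- **`ord_{s=1} L(E_p, s) = 1` for every prime `p ≡ 4, 7, 8 (mod 9)` — modulo the rank-one
`3`-converse `hK3`** (Kříž v5 Thm. 10.14 (2): "`r_an(E_d/ℚ) = 1`"; Fan–Wan v2, proof of Thm. 1.2: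
"the `L`-function of `E_p` has order `1`"). Inputs: `r_3(E_p) = 1`
(`selmerCorank_three_cubeSumCurve_prime_eq_one`, published) and `hK3` (UNREFEREED CLAIM).
[cite: Kriz2020, Thm. 10.14 (2) of v5] -/
theorem analyticRank_eq_one_cubeSumCurve_prime_of_converse
    (hK3 : rankOne_threeConverse_mordellCurve)
    (hSel : satge_selmerCorank_three_le_one_of_prime_mod_nine)
    (hw : rootNumber_cubeSumCurve_prime_eq_neg_one_of_mod_nine)
    (hpar : ∀ (W : WeierstrassCurve ℚ) [W.IsElliptic] (p : ℕ) [Fact p.Prime], p_parity W p)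
    {p : ℕ} (hp : p.Prime) (h9 : p % 9 = 4 ∨ p % 9 = 7 ∨ p % 9 = 8) :
    (mordellCurve (-(432 * (p : ℚ) ^ 2))).analyticRank = 1 := by
  have hp0 : (p : ℚ) ≠ 0 := by exact_mod_cast hp.ne_zero
  have hD : (-(432 * (p : ℚ) ^ 2) : ℚ) ≠ 0 := neg_ne_zero.mpr (by positivity)
  exact hK3 hD (selmerCorank_three_cubeSumCurve_prime_eq_one hSel hw hpar hp h9)

/-- **`rank E_p(ℚ) = 1` for every prime `p ≡ 4, 7, 8 (mod 9)` — modulo `hK3`** (Kříž v5 Thm.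
10.14 (2) with the display `r_an = r_alg = r_3`; Dasgupta–Voight 2018 §1.2: "The BSD conjecture
together with (1) and (2) then predicts that `rank E_p(ℚ) = 1`"). Inputs: the analytic rank
statement and Gross–Zagier–Kolyvagin (`hGZK`).
[cite: Kriz2020, Thm. 10.14 (2) of v5 (r_alg = 1)] [cite: DasguptaVoight2018, §1.2] -/
theorem mordellWeilRank_eq_one_cubeSumCurve_prime_of_converse
    (hK3 : rankOne_threeConverse_mordellCurve)
    (hGZK : rank_eq_analyticRank_of_analyticRank_le_one)
    (hSel : satge_selmerCorank_three_le_one_of_prime_mod_nine)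
    (hw : rootNumber_cubeSumCurve_prime_eq_neg_one_of_mod_nine)
    (hpar : ∀ (W : WeierstrassCurve ℚ) [W.IsElliptic] (p : ℕ) [Fact p.Prime], p_parity W p)
    {p : ℕ} (hp : p.Prime) (h9 : p % 9 = 4 ∨ p % 9 = 7 ∨ p % 9 = 8) :
    (mordellCurve (-(432 * (p : ℚ) ^ 2))).mordellWeilRank = 1 := by
  have hp0 : (p : ℚ) ≠ 0 := by exact_mod_cast hp.ne_zero
  have hD : (-(432 * (p : ℚ) ^ 2) : ℚ) ≠ 0 := neg_ne_zero.mpr (by positivity)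
  haveI := isElliptic_mordellCurve hD
  have hran := analyticRank_eq_one_cubeSumCurve_prime_of_converse hK3 hSel hw hpar hp h9
  rw [(hGZK (mordellCurve (-(432 * (p : ℚ) ^ 2))) hran.le).1, hran]

/-- **Sylvester's problem (1879) modulo ONE unrefereed input.** If Kříž's rank-one `3`-converse
for the curves `y² = x³ + D` holds (`hK3 : rankOne_threeConverse_mordellCurve`, arXiv:2002.04767v5
Thm. 10.13/10.14 — CLAIMED, UNREFEREED; independently claimed by Fan–Wan arXiv:2304.09806v2
Thm. 1.1/1.2), then **every prime `p ≡ 4, 7, 8 (mod 9)` is a sum of two rational cubes**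
(Dasgupta–Voight 2018, Conjecture 1 (Sylvester, Selmer)). The remaining inputs are published and
named: Gross–Zagier–Kolyvagin (`hGZK`), Satgé 1986 Thm. 2.9 (`hSel`), the root number `−1`
(`hw`, Dasgupta–Voight 2018 (2)), Dokchitser–Dokchitser's `p`-parity theorem (`hpar`). Chain:
`r_3(E_p) ≤ 1 ∧ w = −1 ∧ parity ⟹ r_3 = 1 ⟹[hK3] r_an = 1 ⟹[GZK] rank = 1 ⟹ affine point on
`Y² = X³ − 432p²` ⟹ x³ + y³ = p`.
[cite: Kriz2020, Thm. 10.14 (2) of v5 (= Cor. 8.6 of v1)] [cite: DasguptaVoight2018, Conj. 1] -/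
theorem sylvester_exists_cube_add_cube_eq_prime_of_converse
    (hK3 : rankOne_threeConverse_mordellCurve)
    (hGZK : rank_eq_analyticRank_of_analyticRank_le_one)
    (hSel : satge_selmerCorank_three_le_one_of_prime_mod_nine)
    (hw : rootNumber_cubeSumCurve_prime_eq_neg_one_of_mod_nine)
    (hpar : ∀ (W : WeierstrassCurve ℚ) [W.IsElliptic] (p : ℕ) [Fact p.Prime], p_parity W p)
    {p : ℕ} (hp : p.Prime) (h9 : p % 9 = 4 ∨ p % 9 = 7 ∨ p % 9 = 8) :
    ∃ x y : ℚ, x ^ 3 + y ^ 3 = p :=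
  exists_cube_add_cube_of_selmerCorank_three_eq_one hK3 hGZK (by exact_mod_cast hp.ne_zero)
    (selmerCorank_three_cubeSumCurve_prime_eq_one hSel hw hpar hp h9)

/-! ### The same with Satgé's bound in the weaker form printed by Fan–Wan (`corank ≤ 2`)

The cell referee (STATEMENT-SCORES.md §2a) and the literature audit (V5-EXTERNAL-INPUTS-AUDIT.md
§7) record that `hSel` (`corank_{ℤ₃} Sel_{3^∞}(E_p) ≤ 1`) is an APPLICATION of Satgé's Thm. 2.9
through the descent sequence, while the sentence actually printed downstream is the weaker
"By [Sta, Theorem 2.9], the `3`-adic Selmer rank of `E_p` is less than or equal to `2`" (Fan–Wan,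
arXiv:2304.09806v2, proof of Thm. 1.2, FanWan_v2.tex l. 523). The theorems below take that weaker
bound as an INLINE hypothesis `hSel2` (no new named fact; `hSel` implies it,
`satge_le_two_of_le_one`) and reach the same conclusions: with `w(E_p) = −1` the `3`-parity
theorem excludes the coranks `0` and `2`. -/

/-- `corank ≤ 1 ⟹ corank ≤ 2` for the Satgé input (the tree's named fact implies Fan–Wan's
printed reading). [cite: FanWan2023, proof of Thm. 1.2 (v2, l. 523)] -/
theorem satge_le_two_of_le_one (hSel : satge_selmerCorank_three_le_one_of_prime_mod_nine) :
    ∀ ⦃p : ℕ⦄, p.Prime → (p % 9 = 4 ∨ p % 9 = 7 ∨ p % 9 = 8) →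
      (mordellCurve (-(432 * (p : ℚ) ^ 2))).selmerCorank 3 ≤ 2 :=
  fun _ hp h9 ↦ (hSel hp h9).trans one_le_two

/-- **The parity step from `corank ≤ 2`** (Fan–Wan v2, proof of Thm. 1.2: "the `3`-adic Selmer
rank is odd. Thus it must be `1`"): if `(-1)^{corank Sel_{p^∞}(E)} = w(E)` (`p_parity`),
`corank ≤ 2` and `w(E) = −1`, then the corank is `1` (`0` and `2` give sign `+1`).
[cite: FanWan2023, proof of Thm. 1.2 (v2, l. 523)] [cite: DokchitserDokchitserAnnals2010, Thm. 1.4] -/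
theorem selmerCorank_eq_one_of_le_two_of_rootNumber_eq_neg_one (W : WeierstrassCurve ℚ)
    [W.IsElliptic] (p : ℕ) [Fact p.Prime] (hpar : p_parity W p) (hle : W.selmerCorank p ≤ 2)
    (hw : W.rootNumber = -1) : W.selmerCorank p = 1 := by
  unfold p_parity at hpar
  rw [hw] at hpar
  obtain h | h | h : W.selmerCorank p = 0 ∨ W.selmerCorank p = 1 ∨ W.selmerCorank p = 2 := by
    omega
  · rw [h] at hpar; norm_num at hpar
  · exact h
  · rw [h] at hpar; norm_num at hpar

/-- **`corank_{ℤ₃} Sel_{3^∞}(E_p/ℚ) = 1` for primes `p ≡ 4, 7, 8 (mod 9)` from the WEAKER Satgé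
bound `≤ 2`** (`hSel2`, inline), the root number `−1` (`hw`) and `3`-parity (`hpar`) — verbatim
the argument of Fan–Wan v2, proof of Thm. 1.2. [cite: FanWan2023, proof of Thm. 1.2 (v2, l. 523)]
[cite: Satge1986, Thm. 2.9] [cite: DasguptaVoight2018, §1.1 display (2)] -/
theorem selmerCorank_three_cubeSumCurve_prime_eq_one_of_le_two
    (hSel2 : ∀ ⦃p : ℕ⦄, p.Prime → (p % 9 = 4 ∨ p % 9 = 7 ∨ p % 9 = 8) →
      (mordellCurve (-(432 * (p : ℚ) ^ 2))).selmerCorank 3 ≤ 2)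
    (hw : rootNumber_cubeSumCurve_prime_eq_neg_one_of_mod_nine)
    (hpar : ∀ (W : WeierstrassCurve ℚ) [W.IsElliptic] (p : ℕ) [Fact p.Prime], p_parity W p)
    {p : ℕ} (hp : p.Prime) (h9 : p % 9 = 4 ∨ p % 9 = 7 ∨ p % 9 = 8) :
    (mordellCurve (-(432 * (p : ℚ) ^ 2))).selmerCorank 3 = 1 := by
  have hp0 : (p : ℚ) ≠ 0 := by exact_mod_cast hp.ne_zero
  have hD : (-(432 * (p : ℚ) ^ 2) : ℚ) ≠ 0 := neg_ne_zero.mpr (by positivity)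
  haveI := isElliptic_mordellCurve hD
  haveI : Fact (Nat.Prime 3) := ⟨Nat.prime_three⟩
  exact selmerCorank_eq_one_of_le_two_of_rootNumber_eq_neg_one _ 3 (hpar _ 3) (hSel2 hp h9)
    (hw hp h9)

/-- **Sylvester's problem (1879) modulo ONE unrefereed input, with Satgé's bound in Fan–Wan's
printed form `corank ≤ 2`** (twin of `sylvester_exists_cube_add_cube_eq_prime_of_converse`):
`hK3` (Kříž's rank-one `3`-converse, the unrefereed binder) → `hGZK` → `hSel2` (inline:
`corank_{ℤ₃} Sel_{3^∞}(E_p) ≤ 2` for primes `p ≡ 4, 7, 8 (mod 9)`; Satgé Thm. 2.9 as read by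
Fan–Wan v2 l. 523) → `hw` → `hpar` → every prime `p ≡ 4, 7, 8 (mod 9)` is a sum of two rational
cubes. [cite: Kriz2020, Thm. 10.14 (2) of v5] [cite: FanWan2023, Thm. 1.2 and its proof (v2)]
[cite: DasguptaVoight2018, Conj. 1] -/
theorem sylvester_exists_cube_add_cube_eq_prime_of_converse_of_le_two
    (hK3 : rankOne_threeConverse_mordellCurve)
    (hGZK : rank_eq_analyticRank_of_analyticRank_le_one)
    (hSel2 : ∀ ⦃p : ℕ⦄, p.Prime → (p % 9 = 4 ∨ p % 9 = 7 ∨ p % 9 = 8) →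
      (mordellCurve (-(432 * (p : ℚ) ^ 2))).selmerCorank 3 ≤ 2)
    (hw : rootNumber_cubeSumCurve_prime_eq_neg_one_of_mod_nine)
    (hpar : ∀ (W : WeierstrassCurve ℚ) [W.IsElliptic] (p : ℕ) [Fact p.Prime], p_parity W p)
    {p : ℕ} (hp : p.Prime) (h9 : p % 9 = 4 ∨ p % 9 = 7 ∨ p % 9 = 8) :
    ∃ x y : ℚ, x ^ 3 + y ^ 3 = p :=
  exists_cube_add_cube_of_selmerCorank_three_eq_one hK3 hGZK (by exact_mod_cast hp.ne_zero)
    (selmerCorank_three_cubeSumCurve_prime_eq_one_of_le_two hSel2 hw hpar hp h9)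

end Literature.NumberTheory.EllipticCurves
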